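import Literature.AlgebraicGeometry.Resolution.AlterationsSectionDivisor
import Literature.AlgebraicGeometry.Resolution.AlterationsBoundarySmoothLocus
import Literature.AlgebraicGeometry.Resolution.SemiStableCurvesDimension
import Literature.AlgebraicGeometry.Resolution.AlterationsNodalFibre
import HarnessLib

/-!
# `WildQuotients.SummitReduction` (stmt-ResolutionOfSingularities-16324), line `FramePerfect`, skeleton v8:
# stub `stub_pair_quasiSplitNormalForm` (N) — helper file 1: dimension bookkeeping at closed points
# and "the boundary is a divisor" (de Jong 1996, 4.24 [B1]) over an ARBITRARY field

Route `ResolutionOfSingularities/WildQuotients`, crux `SummitReduction`; sub-goals of the registered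
stub `stub_pair_quasiSplitNormalForm` of the line skeleton `Cruxes/SummitReduction/Lines/FramePerfect.lean`
(v8, lead c4). Worker file.

The tree proves de Jong 1996, 4.24 [B1] ("Furthermore, it [`Z = ⋃ᵢ τᵢ(Y) ∪ f⁻¹(D)`] is a divisor,
as `D` is a divisor and `τᵢ(Y)` is a divisor", p. 75) for pairs in Situation 4.23 over an
ALGEBRAICALLY CLOSED field (`DeJong1996SemiStableBoundaryIsDivisor_holds`,
`AlterationsSectionDivisor.lean`). Algebraic closedness enters at exactly one place: the fibre
dimension `dim 𝒪_{X_{f x}, x} = 1` at a closed point `x` of the smooth locus, read off the GEOMETRIC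
fibre (2.21). Here it is replaced by the dimension count `dim 𝒪_{X,x} = dim X = dim Y + 1 =
dim 𝒪_{Y,f x} + 1` at closed points of the varieties `X`, `Y` (`ringKrullDim_stalk_eq_of_isClosed`,
`IsSemiStableCurve.topologicalKrullDim_eq`) and EGA IV₂ 6.1.2, valid over any field:

* `ringKrullDim_stalk_eq_base_add_one_of_isClosed`, `ringKrullDim_stalk_fiber_eq_one_of_isClosed` —
  the two dimension counts at a closed point of `X`;
* `exists_stalkIdeal_ker_eq_span_singleton_of_isClosed` — the germ of the ideal of a section
  `τᵢ(Y)` at a closed point is principal and non-zero (the tree's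
  `SemiStablePair.exists_stalkIdeal_ker_eq_span_singleton` verbatim, with the new dimension count);
* `exists_isEffectiveCartier_range_section`, `exists_isEffectiveCartier_semiStableBoundary'` — [B1]:
  each `τᵢ(Y)` and the boundary `Z` are supports of effective Cartier divisors.
-/

set_option linter.dupNamespace false

noncomputable section

open CategoryTheory CategoryTheory.Limits AlgebraicGeometry TopologicalSpace Topology
open Literature.AlgebraicGeometry.Resolution
open Literature.AlgebraicGeometry
open IsLocalRing Order Scheme.IdealSheafData

namespace Summit.ResolutionOfSingularities.ResolutionOfSingularities.Theorems

universe u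

section Local

variable {k : Type u} [Field k] {X Y : Scheme.{u}} {f : X ⟶ Y} {g : Y ⟶ Spec (.of k)}
  {D : Set Y} {n : ℕ} {τ : Fin n → (Y ⟶ X)}

/-! ## Dimensions at a closed point -/

/-- **`dim 𝒪_{X,x} = dim 𝒪_{Y,f x} + 1` at every closed point of the total space of a pair in
Situation 4.23, over any field**: `x` and `f x` are closed points of the varieties `X` and `Y`, so
their local rings have dimensions `dim X` and `dim Y` (`ringKrullDim_stalk_eq_of_isClosed`), and
`dim X = dim Y + 1` for the semi-stable curve `f` (`IsSemiStableCurve.topologicalKrullDim_eq`).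
[cite: GortzWedhorn2020, Prop. 14.109 (2)] -/
theorem ringKrullDim_stalk_eq_base_add_one_of_isClosed (hS : DeJong1996.SemiStablePair f g D τ)
    {x : X} (hx : IsClosed ({x} : Set X)) :
    ringKrullDim (X.presheaf.stalk x) = ringKrullDim (Y.presheaf.stalk (f x)) + 1 := by
  haveI := hS.isIntegral
  haveI := hS.isIntegral_base
  haveI := hS.locallyOfFiniteType
  haveI : IsProper g :=
    Literature.AlgebraicGeometry.Motives.IsProjectiveOver.isProper (X := Over.mk g)
      hS.isProjectiveOver_base
  haveI := hS.isNoetherian_base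
  have hy := hS.isClosed_image hx
  rw [ringKrullDim_stalk_eq_of_isClosed (f ≫ g) hx, ringKrullDim_stalk_eq_of_isClosed g hy]
  exact hS.isSemiStableCurve.topologicalKrullDim_eq

/-- **`dim 𝒪_{X_{f x}, x} = 1` at every closed point `x` of the total space of a pair in
Situation 4.23, over any field**: by the dimension formula for the flat `f` (EGA IV₂ 6.1.2,
`coheight_eq_coheight_add_ringKrullDim_stalk_fiber`) and
`ringKrullDim_stalk_eq_base_add_one_of_isClosed`. [cite: GrothendieckDieudonne1965, Cor. (6.1.2), p. 135] -/
theorem ringKrullDim_stalk_fiber_eq_one_of_isClosed (hS : DeJong1996.SemiStablePair f g D τ)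
    {x : X} (hx : IsClosed ({x} : Set X)) :
    ringKrullDim ((f.fiber (f x)).presheaf.stalk (f.asFiber x)) = 1 := by
  haveI := hS.isIntegral
  haveI : IsNoetherian X := DeJong1996.isNoetherian_of_isProjectiveOver _ hS.isProjectiveOver
  haveI := hS.isNoetherian_base
  haveI := hS.isSemiStableCurve.flat
  haveI := hS.isSemiStableCurve.locallyOfFinitePresentation
  haveI : LocallyOfFiniteType (f.fiberToSpecResidueField (f x)) :=
    MorphismProperty.pullback_snd _ _ inferInstance
  haveI : IsLocallyNoetherian (f.fiber (f x)) :=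
    LocallyOfFiniteType.isLocallyNoetherian (f.fiberToSpecResidueField (f x))
  have h3 := Literature.AlgebraicGeometry.Motives.coheight_eq_coheight_add_ringKrullDim_stalk_fiber f x
  have h1 := ringKrullDim_stalk_eq_base_add_one_of_isClosed hS hx
  obtain ⟨a, ha⟩ := exists_ringKrullDim_eq_natCast (Y.presheaf.stalk (f x))
  obtain ⟨c, hc⟩ := exists_ringKrullDim_eq_natCast ((f.fiber (f x)).presheaf.stalk (f.asFiber x))
  rw [ringKrullDim_stalk_eq_coheight, ringKrullDim_stalk_eq_coheight] at h1
  rw [ringKrullDim_stalk_eq_coheight] at ha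
  rw [h1, ha, hc] at h3
  rw [hc]
  have h4 : ((a : ℕ∞) : WithBot ℕ∞) + 1 = (a : ℕ∞) + (c : ℕ∞) := by exact_mod_cast h3
  have h5 : (a : ℕ∞) + 1 = (a : ℕ∞) + (c : ℕ∞) := by exact_mod_cast h4
  have h6 : a + 1 = a + c := by exact_mod_cast h5
  have h7 : c = 1 := by omega
  subst h7
  rfl

/-! ## The germ of the ideal of a section is principal -/

/-- **The germ of the ideal of a section is principal, over any field** (the local content of
"`τᵢ(Y)` is a divisor", de Jong 1996, 4.24): at a closed point `x = τᵢ(y)`, the stalk of the kernel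
ideal sheaf of the closed immersion `τᵢ` is generated by one non-zero element of the regular
(3.1), hence factorial, local ring `𝒪_{X,x}` — it is the prime `P = ker(𝒪_{X,x} → 𝒪_{Y,y})` with
`dim 𝒪_{X,x}/P = dim 𝒪_{Y,y} = dim 𝒪_{X,x} - 1` (`ringKrullDim_stalk_eq_base_add_one_of_isClosed`).
The tree's `SemiStablePair.exists_stalkIdeal_ker_eq_span_singleton` verbatim but for the dimension
count. [cite: DeJong1996, 4.24, p. 75] -/
theorem exists_stalkIdeal_ker_eq_span_singleton_of_isClosed (hS : DeJong1996.SemiStablePair f g D τ)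
    (i : Fin n) (y : Y) (hy : IsClosed ({τ i y} : Set X)) :
    ∃ p : X.presheaf.stalk (τ i y), p ≠ 0 ∧ stalkIdeal (τ i).ker (τ i y) = Ideal.span {p} := by
  haveI := hS.isClosedImmersion i
  haveI := hS.isNoetherian_base
  haveI : IsRegularLocalRing (X.presheaf.stalk (τ i y)) := hS.isRegularLocalRing_stalk_apply i y
  haveI : IsDomain (X.presheaf.stalk (τ i y)) := isDomain_of_isRegularLocalRing _
  haveI : UniqueFactorizationMonoid (X.presheaf.stalk (τ i y)) :=
    IsRegularLocalRing.uniqueFactorizationMonoid _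
  -- `P = ker (𝒪_{X, τ y} → 𝒪_{Y, y})`, a surjection onto `𝒪_{Y,y}`
  have hP := stalkIdeal_ker_eq_ker_stalkMap (τ i) y
  have hsurj : Function.Surjective ((τ i).stalkMap y).hom := (τ i).stalkMap_surjective y
  -- dimensions: `dim 𝒪_{Y,y} = m`, `dim 𝒪_{X,τ y} = m + 1`
  obtain ⟨m, hm⟩ := ringKrullDim_eq_nat (Y.presheaf.stalk y)
  have hfy : f (τ i y) = y := by
    rw [← Scheme.Hom.comp_apply, hS.comp_eq_id]
    rfl
  have hB : ringKrullDim (X.presheaf.stalk (τ i y)) = (m + 1 : ℕ) := by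
    have h := ringKrullDim_stalk_eq_base_add_one_of_isClosed hS hy
    rw [hfy, hm] at h
    rw [h]
    rfl
  have hBP : ringKrullDim (X.presheaf.stalk (τ i y) ⧸ stalkIdeal (τ i).ker (τ i y)) = m := by
    rw [hP, ringKrullDim_eq_of_ringEquiv (RingHom.quotientKerEquivOfSurjective hsurj), hm]
  have hne : stalkIdeal (τ i).ker (τ i y) ≠ ⊥ := by
    intro h0
    rw [h0, ringKrullDim_eq_of_ringEquiv (RingEquiv.quotientBot _), hB] at hBP
    have h1 : ((m + 1 : ℕ) : WithBot ℕ∞) = (m : ℕ) := hBP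
    have h2 := ENat.coe_inj.mp (WithBot.coe_inj.mp h1)
    omega
  haveI : IsDomain (Y.presheaf.stalk y) :=
    haveI := hS.isRegular_base y
    isDomain_of_isRegularLocalRing _
  haveI : (stalkIdeal (τ i).ker (τ i y)).IsPrime := by
    rw [hP]
    exact RingHom.ker_isPrime _
  obtain ⟨p, hp, hPp⟩ := Ideal.exists_eq_span_singleton_of_ringKrullDim_quotient _ hne hB hBP
  exact ⟨p, hp.ne_zero, hPp⟩

/-! ## [B1]: the sections and the boundary are divisors -/

/-- **de Jong 1996, 4.24: "`τᵢ(Y)` is a divisor", over any field.** The image of each section `τᵢ`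
of a pair in Situation 4.23 is the support of an effective Cartier divisor, namely of the kernel
ideal sheaf of the closed immersion `τᵢ`: at every closed point its stalk is a non-zero principal
ideal (`exists_stalkIdeal_ker_eq_span_singleton_of_isClosed`), which suffices on the Jacobson
scheme `X` (`isEffectiveCartier_of_stalkIdeal_eq_span_singleton_of_isClosed`).
[cite: DeJong1996, 4.24, p. 75] -/
theorem exists_isEffectiveCartier_range_section (hS : DeJong1996.SemiStablePair f g D τ)
    (i : Fin n) :
    ∃ I : X.IdealSheafData, IsEffectiveCartier I ∧ (I.support : Set X) = Set.range (τ i) := by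
  haveI := hS.isIntegral
  haveI : IsNoetherian X := DeJong1996.isNoetherian_of_isProjectiveOver _ hS.isProjectiveOver
  haveI := hS.isClosedImmersion i
  haveI := hS.locallyOfFiniteType
  haveI : JacobsonSpace ↥X := LocallyOfFiniteType.jacobsonSpace (f ≫ g)
  refine ⟨(τ i).ker, isEffectiveCartier_of_stalkIdeal_eq_span_singleton_of_isClosed ?_, ?_⟩
  · intro x hx hxc
    have hx' : x ∈ Set.range (τ i) := by
      have : x ∈ ((τ i).ker.support : Set X) := hx
      rw [Scheme.Hom.support_ker, (τ i).isClosedEmbedding.isClosed_range.closure_eq] at this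
      exact this
    obtain ⟨y, rfl⟩ := hx'
    exact exists_stalkIdeal_ker_eq_span_singleton_of_isClosed hS i y hxc
  · rw [Scheme.Hom.support_ker, (τ i).isClosedEmbedding.isClosed_range.closure_eq]

end Local

/-- **de Jong 1996, 4.24 [B1], over any field: "Furthermore, it is a divisor, as `D` is a divisor
and `τᵢ(Y)` is a divisor"** — the boundary `Z = ⋃ᵢ τᵢ(Y) ∪ f⁻¹(D)` of a pair in Situation 4.23 is
the support of an effective Cartier divisor (the product of the kernel ideal sheaves of the
sections and the flat pull-back of the radical ideal sheaf of `D`). [cite: DeJong1996, 4.24, p. 75] -/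
theorem exists_isEffectiveCartier_semiStableBoundary' {k : Type u} [Field k] {X Y : Scheme.{u}}
    {f : X ⟶ Y} {g : Y ⟶ Spec (.of k)} {D : Set Y} {n : ℕ} {τ : Fin n → (Y ⟶ X)}
    (hS : DeJong1996.SemiStablePair f g D τ) :
    ∃ I : X.IdealSheafData, IsEffectiveCartier I ∧
      (I.support : Set X) = DeJong1996.semiStableBoundary f D τ := by
  obtain ⟨I, hI, hIZ⟩ := exists_isEffectiveCartier_iUnion (fun i => Set.range (τ i))
    (exists_isEffectiveCartier_range_section hS)
  obtain ⟨J, hJ, hJD⟩ := hS.exists_isEffectiveCartier_preimage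
  refine ⟨I * J, hI.mul hJ, ?_⟩
  rw [support_mul, Closeds.coe_sup, hIZ, hJD]
  rfl

end Summit.ResolutionOfSingularities.ResolutionOfSingularities.Theorems

end
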